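import Literature.AlgebraicGeometry.Motives.AbelianVarietyFrobeniusDescent
import Literature.AlgebraicGeometry.Motives.AbelianVarietyEndAlgebraDescent
import Mathlib.RingTheory.Localization.BaseChange
import HarnessLib

/-!
# Descent of the semisimplicity of `End⁰` from `K̄` to a finite field `K` through the Frobenius

For an abelian variety `P` over a **finite** field `K`, `End⁰_K(P) = ℚ ⊗ End_K(P)` is semisimple as
soon as `End⁰(P_K̄)` is semisimple and `End(P_K̄)`, `End_K(P)` are finitely generated
(`AbelianVariety.isSemisimpleRing_endAlgebra_of_baseChange_algebraicClosure`) — a hypothesis-light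
form of the descent step in Tate's theorem over finite fields (J. Tate, *Endomorphisms of abelian
varieties over finite fields*, Invent. Math. 2 (1966), §1; Milne, *The Work of John Tate*, §4.3),
complementary to the Galois-action route of `Motives/AbelianVarietyEndGaloisDescent` /
`Motives/AbelianVarietyEndGaloisFinite` (which needs the Theorem of the Cube for the `ℓ`-adic
continuity of the Galois action): here only the Frobenius is used. With Mumford §19 over `K̄` (cube
and Poincaré) this gives the semisimplicity of `End⁰_K(P)` for every `P` over a finite field
(`AbelianVariety.isSemisimpleRing_endAlgebra_of_theoremOfCube_of_poincare_algebraicClosure`).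

## The descent (Tate 1966, §1)

Let `π ∈ End_K(P)` be the Frobenius endomorphism (`Motives/AbelianVarietyFrobeniusTwist`) and
`φ : End_K(P) → End(P_K̄)` the injective base change. By `Motives/AbelianVarietyFrobeniusDescent`,
the image of `φ` is the commutant of `π_K̄` and some power `πᴺ_K̄`, `N ≥ 1`, is central in the
finitely generated ring `End(P_K̄)`. Then `S(r) = ∑_{i<N} πⁱ_K̄ r π^{N-i}_K̄` commutes with `π_K̄`,
so `τ = φ⁻¹ ∘ S : End(P_K̄) → End_K(P)` is a well-defined additive `End_K(P)`-bimodule map with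
`τ(1) = N πᴺ`, a central element of `End_K(P)` which is a unit of `End⁰_K(P)` (`πᴺ` is left- and
right-cancellable in `End_K(P)` — the `qᴺ`-power endomorphism of the reduced scheme `P` is an
epimorphism and is cancellable against reduced sources, `eq_of_comp_powEndo_eq` — and `End_K(P)` is
finitely generated, `isUnit_one_tmul_nsmul_of_cancel`). Hence `t = (1 ⊗ N πᴺ)⁻¹ (ℚ ⊗ τ)` is a
bimodule retraction of `ℚ ⊗ φ : End⁰_K(P) → End⁰(P_K̄)`, and semisimplicity descends along bimodule
retractions (`Literature.RingTheory.SimpleModule.isSemisimpleRing_of_retraction`;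
`isSemisimpleRing_ratTensor_of_trace_central` generalises `isSemisimpleRing_ratTensor_of_trace` to
a central, rationally invertible value of `τ(1)`).

## Main statements

* `eq_of_comp_powEndo_eq` — power endomorphisms are cancellable against reduced sources;
  `AbelianVariety.eq_of_frobeniusHom_pow_mul_eq`, `AbelianVariety.eq_of_mul_frobeniusHom_pow_eq`
  (`πⁿ` is a non-zero-divisor of `End_K(P)`, on both sides).
* `isSemisimpleRing_ratTensor_of_trace_central`, `isUnit_one_tmul_nsmul_of_cancel` (pure algebra:
  `ℚ ⊗_ℤ R₀` as the localisation of `R₀` at the non-zero integers, Mathlib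
  `IsLocalization.tensorProduct_isLocalizedModule`).
* `AbelianVariety.isSemisimpleRing_endAlgebra_of_baseChange_algebraicClosure`,
  `AbelianVariety.isSemisimpleRing_endAlgebra_of_theoremOfCube_of_poincare_algebraicClosure`.

No definition, no named fact, no `_holds` of an existing fact is introduced (D-0026). Tate's Main
Theorem over a finite field from the cube, Poincaré over `K̄` and `finite_isoClasses_of_finite` is
already assembled in `Motives/AbelianVarietyEndGaloisFinite`
(`tate_bijective_of_finite_of_theoremOfCube_of_poincare_algebraicClosure`) and is not restated.

## References

* [Tate1966Endomorphisms] J. Tate, *Endomorphisms of abelian varieties over finite fields*,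
  Invent. Math. 2 (1966), 134–144, §1 — not held (doi:10.1007/bf01404549); as reported in Milne,
  *The Work of John Tate*, §4.3 (arXiv:1210.7459, held). [Milne2013WorkOfTate]
* [MumfordAV1970] D. Mumford, *Abelian Varieties* (1970), §19 Thm. 1, Cor. 2, Thm. 3.
* [CohenMontgomery1975] M. Cohen, S. Montgomery, *Semi-simple artinian rings of fixed points*,
  Canad. Math. Bull. 18 (1975) (the retraction argument).
-/

noncomputable section

universe u

open CategoryTheory CategoryTheory.Limits AlgebraicGeometry MonoidalCategory
open scoped TensorProduct

namespace Literature.AlgebraicGeometry.Motives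

/-! ## Power endomorphisms are left-cancellable against reduced sources -/

section PowEndoMono

/-- **Morphisms from a reduced scheme are determined by their composite with a power
endomorphism**: if `a ≫ F = b ≫ F` for the power endomorphism `F` (`s ↦ sⁿ` on functions, additive)
of `X` and `a, b : Z → X` with `Z` reduced (and `s ↦ sⁿ` additive on `Z` too), then `a = b`
(`a^*(s)ⁿ = b^*(s)ⁿ` in the reduced rings of sections of `Z`). [folklore] -/
theorem eq_of_comp_powEndo_eq {Z X : Scheme.{u}} [IsReduced Z] (n : ℕ) (hn : n ≠ 0)
    (hadd : ∀ (U : X.Opens) (a b : Γ(X, U)), (a + b) ^ n = a ^ n + b ^ n)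
    (haddZ : ∀ (U : Z.Opens) (a b : Γ(Z, U)), (a + b) ^ n = a ^ n + b ^ n) {a b : Z ⟶ X}
    (H : a ≫ powEndo X n hn hadd = b ≫ powEndo X n hn hadd) : a = b := by
  have hbase : a.base = b.base := by
    have := congrArg (fun f ↦ f.base) H
    simpa only [Scheme.Hom.comp_base, powEndo_base, Category.comp_id] using this
  refine Scheme.Hom.ext hbase fun U ↦ ?_
  ext s
  apply pow_injective_of_isReduced (haddZ ((TopologicalSpace.Opens.map b.base).obj U))
  have hU := DFunLike.congr_fun (congrArg CommRingCat.Hom.hom (Scheme.Hom.congr_app H U)) s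
  have hU' : (a.app U).hom (s ^ n) =
      (Z.presheaf.map (eqToHom _).op).hom ((b.app U).hom (s ^ n)) := hU
  rw [map_pow, map_pow] at hU'
  change ((Z.presheaf.map (eqToHom _).op).hom ((a.app U).hom s)) ^ n = ((b.app U).hom s) ^ n
  rw [← map_pow, hU']
  exact presheaf_map_eqToHom_map_eqToHom Z _ _ _

end PowEndoMono

namespace AbelianVariety

/-! ## Cancellation of powers of the Frobenius endomorphism over `K` -/

section FrobeniusCancel

variable {K : Type u} [Field K] [Finite K] (P : AbelianVariety K)

/-- **`πⁿ` is left-cancellable in `End(P)`**: `πⁿ ∘ g = πⁿ ∘ g'` (i.e. `g ≫ πⁿ = g' ≫ πⁿ`)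
implies `g = g'` (`P` is reduced and `πⁿ` is the `qⁿ`-power endomorphism). [folklore] -/
theorem eq_of_frobeniusHom_pow_mul_eq (n : ℕ) {g g' : End P}
    (h : End.of (frobeniusHom P) ^ n * g = End.of (frobeniusHom P) ^ n * g') : g = g' := by
  haveI : IsIntegral P.X.left := GeometricallyIntegral.isIntegral_of_subsingleton P.X.hom
  rw [End.mul_def, End.mul_def] at h
  have h' := congrArg Hom.toSchemeHom h
  change Hom.toSchemeHom g ≫ Hom.toSchemeHom (End.of (frobeniusHom P) ^ n) =
    Hom.toSchemeHom g' ≫ Hom.toSchemeHom (End.of (frobeniusHom P) ^ n) at h'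
  rw [toSchemeHom_frobeniusHom_pow] at h'
  exact hom_ext _ _ (Over.OverMorphism.ext
    (eq_of_comp_powEndo_eq _ _ _ (add_pow_card_pow_sections P.X n) h'))

/-- **`πⁿ` is right-cancellable in `End(P)`**: `g ∘ πⁿ = g' ∘ πⁿ` implies `g = g'` (`πⁿ` is an
epimorphism of the reduced scheme `P`). [folklore] -/
theorem eq_of_mul_frobeniusHom_pow_eq (n : ℕ) {g g' : End P}
    (h : g * End.of (frobeniusHom P) ^ n = g' * End.of (frobeniusHom P) ^ n) : g = g' := by
  haveI : IsIntegral P.X.left := GeometricallyIntegral.isIntegral_of_subsingleton P.X.hom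
  haveI : Epi (Hom.toSchemeHom (End.of (frobeniusHom P) ^ n)) := by
    rw [toSchemeHom_frobeniusHom_pow]
    exact epi_powEndo _ _ _ _
  rw [End.mul_def, End.mul_def] at h
  have h' := congrArg Hom.toSchemeHom h
  change Hom.toSchemeHom (End.of (frobeniusHom P) ^ n) ≫ Hom.toSchemeHom g =
    Hom.toSchemeHom (End.of (frobeniusHom P) ^ n) ≫ Hom.toSchemeHom g' at h'
  exact hom_ext _ _ (Over.OverMorphism.ext ((cancel_epi _).mp h'))

end FrobeniusCancel

end AbelianVariety

/-! ## Two lemmas on `ℚ ⊗_ℤ R₀` -/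

section RatTensor

open scoped TensorProduct

variable {S₀ R₀ : Type*} [Ring S₀] [Ring R₀]

/-- **Semisimplicity of `ℚ ⊗ S₀` from that of `ℚ ⊗ R₀` along an integral trace with central
value at `1`.** As `Literature.RingTheory.SimpleModule.isSemisimpleRing_ratTensor_of_trace`, but with
`τ 1 = c` a *central* element of `S₀` that becomes a unit in `ℚ ⊗ S₀` (instead of a non-zero
integer): `t = (1 ⊗ c)⁻¹ · (ℚ ⊗ τ)` is an `ℚ ⊗ S₀`-bimodule retraction of `ℚ ⊗ φ`, so
`isSemisimpleRing_of_retraction` applies. [folklore] -/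
theorem isSemisimpleRing_ratTensor_of_trace_central (φ : S₀ →+* R₀) (τ : R₀ →+ S₀) (c : S₀)
    (hl : ∀ (a : S₀) (r : R₀), τ (φ a * r) = a * τ r)
    (hr : ∀ (r : R₀) (b : S₀), τ (r * φ b) = τ r * b) (h1 : τ 1 = c)
    (hcu : IsUnit ((1 : ℚ) ⊗ₜ[ℤ] c : ℚ ⊗[ℤ] S₀)) (hcc : ∀ a : S₀, Commute c a)
    [IsSemisimpleRing (ℚ ⊗[ℤ] R₀)] : IsSemisimpleRing (ℚ ⊗[ℤ] S₀) := by
  -- `f = ℚ ⊗ φ`, `t₀ = ℚ ⊗ τ`, `t = v⁻¹ · t₀` with `v = 1 ⊗ c`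
  let f : ℚ ⊗[ℤ] S₀ →+* ℚ ⊗[ℤ] R₀ :=
    (Algebra.TensorProduct.map (AlgHom.id ℤ ℚ) φ.toIntAlgHom).toRingHom
  let t₀ : ℚ ⊗[ℤ] R₀ →+ ℚ ⊗[ℤ] S₀ :=
    (TensorProduct.map (LinearMap.id (R := ℤ) (M := ℚ)) τ.toIntLinearMap).toAddMonoidHom
  let v : (ℚ ⊗[ℤ] S₀)ˣ := hcu.unit
  let t : ℚ ⊗[ℤ] R₀ →+ ℚ ⊗[ℤ] S₀ := (AddMonoidHom.mulLeft ((v⁻¹ : (ℚ ⊗[ℤ] S₀)ˣ) : ℚ ⊗[ℤ] S₀)).comp t₀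
  have hf : ∀ (q : ℚ) (a : S₀), f (q ⊗ₜ[ℤ] a) = q ⊗ₜ[ℤ] φ a := fun q a ↦
    Algebra.TensorProduct.map_tmul _ _ q a
  have ht₀ : ∀ (q : ℚ) (r : R₀), t₀ (q ⊗ₜ[ℤ] r) = q ⊗ₜ[ℤ] τ r := fun q r ↦
    TensorProduct.map_tmul _ _ q r
  have ht : ∀ x, t x = ((v⁻¹ : (ℚ ⊗[ℤ] S₀)ˣ) : ℚ ⊗[ℤ] S₀) * t₀ x := fun x ↦ rfl
  -- `v = 1 ⊗ c` is central, hence so is `v⁻¹`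
  have hvc : ∀ y : ℚ ⊗[ℤ] S₀, Commute (v : ℚ ⊗[ℤ] S₀) y := by
    intro y
    rw [IsUnit.unit_spec]
    induction y using TensorProduct.induction_on with
    | zero => exact Commute.zero_right _
    | add y₁ y₂ h₁ h₂ => exact h₁.add_right h₂
    | tmul q a =>
      change (1 : ℚ) ⊗ₜ[ℤ] c * q ⊗ₜ[ℤ] a = q ⊗ₜ[ℤ] a * (1 : ℚ) ⊗ₜ[ℤ] c
      rw [Algebra.TensorProduct.tmul_mul_tmul, Algebra.TensorProduct.tmul_mul_tmul, one_mul,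
        mul_one, (hcc a).eq]
  have hvc' : ∀ y : ℚ ⊗[ℤ] S₀, Commute ((v⁻¹ : (ℚ ⊗[ℤ] S₀)ˣ) : ℚ ⊗[ℤ] S₀) y :=
    fun y ↦ Commute.units_inv_left (hvc y)
  -- left and right linearity of `t₀` on pure tensors
  have hl₀ : ∀ x y, t₀ (f x * y) = x * t₀ y := by
    intro x y
    induction x using TensorProduct.induction_on with
    | zero => rw [map_zero, zero_mul, zero_mul, map_zero]
    | add x₁ x₂ h₁ h₂ => rw [map_add, add_mul, map_add, h₁, h₂, add_mul]
    | tmul q a =>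
      induction y using TensorProduct.induction_on with
      | zero => rw [mul_zero, map_zero, mul_zero]
      | add y₁ y₂ h₁ h₂ => rw [mul_add, map_add, h₁, h₂, map_add, mul_add]
      | tmul q' r =>
        rw [hf, Algebra.TensorProduct.tmul_mul_tmul, ht₀, ht₀, Algebra.TensorProduct.tmul_mul_tmul,
          hl]
  have hr₀ : ∀ y x, t₀ (y * f x) = t₀ y * x := by
    intro y x
    induction x using TensorProduct.induction_on with
    | zero => rw [map_zero, mul_zero, mul_zero, map_zero]
    | add x₁ x₂ h₁ h₂ => rw [map_add, mul_add, map_add, h₁, h₂, mul_add]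
    | tmul q b =>
      induction y using TensorProduct.induction_on with
      | zero => rw [zero_mul, map_zero, zero_mul]
      | add y₁ y₂ h₁ h₂ => rw [add_mul, map_add, h₁, h₂, map_add, add_mul]
      | tmul q' r =>
        rw [hf, Algebra.TensorProduct.tmul_mul_tmul, ht₀, ht₀, Algebra.TensorProduct.tmul_mul_tmul,
          hr]
  refine Literature.RingTheory.SimpleModule.isSemisimpleRing_of_retraction f t
    (fun x y ↦ ?_) (fun y x ↦ ?_) ?_
  · rw [ht, ht, hl₀, ← mul_assoc, (hvc' x).eq, mul_assoc]
  · rw [ht, ht, hr₀, mul_assoc]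
  · rw [ht]
    change ((v⁻¹ : (ℚ ⊗[ℤ] S₀)ˣ) : ℚ ⊗[ℤ] S₀) * t₀ ((1 : ℚ) ⊗ₜ[ℤ] (1 : R₀)) = 1
    rw [ht₀, h1, ← IsUnit.unit_spec hcu, Units.inv_mul]

/-- **Cancellable elements of `R₀` become units in the finite-dimensional algebra `ℚ ⊗_ℤ R₀`**:
if `w` is left- and right-cancellable in a ring `R₀` finitely generated as an abelian group, then
`1 ⊗ (N • w)` is a unit of `ℚ ⊗_ℤ R₀` for `N ≠ 0` (left/right multiplication by `1 ⊗ w` is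
injective — clear denominators, `ℚ ⊗_ℤ R₀` being the localisation of `R₀` at the non-zero
integers — hence bijective on the finite-dimensional `ℚ`-vector space `ℚ ⊗ R₀`). [folklore] -/
theorem isUnit_one_tmul_nsmul_of_cancel [Module.Finite ℤ R₀] (w : R₀) (N : ℕ) (hN : N ≠ 0)
    (hlw : ∀ g : R₀, w * g = 0 → g = 0) (hrw : ∀ g : R₀, g * w = 0 → g = 0) :
    IsUnit ((1 : ℚ) ⊗ₜ[ℤ] (N • w) : ℚ ⊗[ℤ] R₀) := by
  set A := ℚ ⊗[ℤ] R₀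
  let ι : R₀ →ₗ[ℤ] A := TensorProduct.mk ℤ ℚ R₀ 1
  haveI : IsLocalizedModule (nonZeroDivisors ℤ) ι :=
    IsLocalization.tensorProduct_isLocalizedModule (S := nonZeroDivisors ℤ) (A := ℚ) (M := R₀)
  have hι : ∀ m : R₀, ι m = (1 : ℚ) ⊗ₜ[ℤ] m := fun m ↦ rfl
  -- clearing denominators: `s • x = 1 ⊗ m` with `s ≠ 0`
  have hrep : ∀ x : A, ∃ (s : nonZeroDivisors ℤ) (m : R₀), (s : ℤ) • x = (1 : ℚ) ⊗ₜ[ℤ] m := by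
    intro x
    obtain ⟨⟨m, s⟩, rfl⟩ := IsLocalizedModule.mk'_surjective (nonZeroDivisors ℤ) ι x
    exact ⟨s, m, by rw [Function.uncurry_apply_pair, ← Submonoid.smul_def,
      IsLocalizedModule.mk'_cancel', hι]⟩
  have hzero : ∀ m : R₀, (1 : ℚ) ⊗ₜ[ℤ] m = (0 : A) → ∃ s : nonZeroDivisors ℤ, (s : ℤ) • m = 0 := by
    intro m hm
    rw [← hι] at hm
    obtain ⟨s, hs⟩ := (IsLocalizedModule.eq_zero_iff (nonZeroDivisors ℤ) ι).mp hm
    exact ⟨s, by rwa [← Submonoid.smul_def]⟩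
  have hsmul : ∀ (s : nonZeroDivisors ℤ) (x : A), (s : ℤ) • x = 0 → x = 0 := by
    intro s x hx
    rw [← Int.cast_smul_eq_zsmul ℚ] at hx
    exact (smul_eq_zero.mp hx).resolve_left (Int.cast_ne_zero.mpr (nonZeroDivisors.ne_zero s.2))
  have htors : ∀ m : R₀, (∃ s : nonZeroDivisors ℤ, (s : ℤ) • m = 0) → (1 : ℚ) ⊗ₜ[ℤ] m = (0 : A) := by
    rintro m ⟨s, hs⟩
    rw [← hι, IsLocalizedModule.eq_zero_iff (nonZeroDivisors ℤ) ι]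
    exact ⟨s, by rwa [Submonoid.smul_def]⟩
  set u : A := (1 : ℚ) ⊗ₜ[ℤ] w with hu
  -- `u` is left- and right-regular in `A`
  have hul : ∀ x : A, u * x = 0 → x = 0 := by
    intro x hx
    obtain ⟨s, m, hsm⟩ := hrep x
    have h1 : u * ((s : ℤ) • x) = 0 := by rw [mul_smul_comm, hx, smul_zero]
    rw [hsm, hu, Algebra.TensorProduct.tmul_mul_tmul, one_mul] at h1
    obtain ⟨s', hs'⟩ := hzero _ h1
    rw [← mul_smul_comm] at hs'
    have hm : (s' : ℤ) • m = 0 := hlw _ hs'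
    exact hsmul s x (hsm ▸ htors m ⟨s', hm⟩)
  have hur : ∀ x : A, x * u = 0 → x = 0 := by
    intro x hx
    obtain ⟨s, m, hsm⟩ := hrep x
    have h1 : ((s : ℤ) • x) * u = 0 := by rw [smul_mul_assoc, hx, smul_zero]
    rw [hsm, hu, Algebra.TensorProduct.tmul_mul_tmul, one_mul] at h1
    obtain ⟨s', hs'⟩ := hzero _ h1
    rw [← smul_mul_assoc] at hs'
    have hm : (s' : ℤ) • m = 0 := hrw _ hs'
    exact hsmul s x (hsm ▸ htors m ⟨s', hm⟩)
  -- hence a unit (finite-dimensional `ℚ`-algebra)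
  haveI : Module.Finite ℚ A := inferInstance
  have hL : Function.Injective (LinearMap.mulLeft ℚ u) := fun x y hxy ↦
    sub_eq_zero.mp (hul _ (by rw [mul_sub]; exact sub_eq_zero.mpr hxy))
  have hR : Function.Injective (LinearMap.mulRight ℚ u) := fun x y hxy ↦
    sub_eq_zero.mp (hur _ (by rw [sub_mul]; exact sub_eq_zero.mpr hxy))
  obtain ⟨y, hy⟩ := (LinearMap.injective_iff_surjective.mp hL) 1
  obtain ⟨z, hz⟩ := (LinearMap.injective_iff_surjective.mp hR) 1
  change u * y = 1 at hy
  change z * u = 1 at hz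
  have hyz : y = z := by rw [← one_mul y, ← hz, mul_assoc, hy, mul_one]
  have huu : IsUnit u := isUnit_iff_exists.mpr ⟨y, hy, hyz ▸ hz⟩
  -- `1 ⊗ (N • w) = N • u`
  have hN' : IsUnit ((N : ℚ) ⊗ₜ[ℤ] (1 : R₀) : A) := by
    have : ((N : ℚ) ⊗ₜ[ℤ] (1 : R₀) : A) = algebraMap ℚ A N := by
      rw [Algebra.TensorProduct.algebraMap_apply, Algebra.algebraMap_self, RingHom.id_apply]
    rw [this]
    exact (IsUnit.mk0 _ (Nat.cast_ne_zero.mpr hN)).map _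
  have heq : ((1 : ℚ) ⊗ₜ[ℤ] (N • w) : A) = ((N : ℚ) ⊗ₜ[ℤ] (1 : R₀)) * u := by
    rw [hu, Algebra.TensorProduct.tmul_mul_tmul, mul_one, one_mul, TensorProduct.tmul_smul,
      TensorProduct.smul_tmul', nsmul_eq_mul, mul_one]
  rw [heq]
  exact hN'.mul huu

end RatTensor

namespace AbelianVariety

/-! ## Semisimplicity of `End⁰_K(P)` from `End⁰(P_K̄)` over a finite field -/

section Semisimple

variable {K : Type u} [Field K] [Finite K] (P : AbelianVariety K)

/-- **Over a finite field, `End⁰(P)` is semisimple as soon as `End⁰(P_K̄)` is and `End(P_K̄)`,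
`End(P)` are finitely generated.** Proof (Tate 1966, §1, descent from `k̄` to `k` through the
Frobenius): let `π ∈ End(P)` be the Frobenius and `φ : End(P) → End(P_K̄)` the (injective) base
change, whose image is the commutant of `π_K̄` (`exists_baseChange_eq_of_commute_frobeniusHom`);
some power `πᴺ_K̄` is central in `End(P_K̄)` (`exists_forall_commute_baseChange_frobeniusHom_pow`:
every endomorphism is defined over some `𝔽_{qⁿ}`), so `S(r) = ∑_{i<N} πⁱ r π^{N-i}` commutes with
`π_K̄` and `τ = φ⁻¹ ∘ S : End(P_K̄) → End(P)` is an `End(P)`-bimodule map with `τ(1) = N πᴺ`, a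
central element of `End(P)` invertible in `End⁰(P)` (`πᴺ` is cancellable on both sides:
`eq_of_frobeniusHom_pow_mul_eq`, `eq_of_mul_frobeniusHom_pow_eq`); hence `End⁰(P)` is a bimodule
retract of the semisimple `End⁰(P_K̄)` and is semisimple
(`isSemisimpleRing_ratTensor_of_trace_central`). [cite: Tate1966Endomorphisms, §1] -/
theorem isSemisimpleRing_endAlgebra_of_baseChange_algebraicClosure
    [Module.Finite ℤ (End (P.baseChange (AlgebraicClosure K)))] [Module.Finite ℤ (End P)]
    (hss : IsSemisimpleRing (endAlgebra (P.baseChange (AlgebraicClosure K)))) :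
    IsSemisimpleRing (endAlgebra P) := by
  classical
  set P' := P.baseChange (AlgebraicClosure K) with hP'
  -- base change of endomorphisms as an injective ring homomorphism `φ`
  let φ : End P →+* End P' :=
    RingHom.mk' ((baseChangeFunctor K (AlgebraicClosure K)).mapEnd P)
      (fun f g ↦ Hom.baseChange_add (AlgebraicClosure K) f g)
  have hφ : ∀ f : End P, φ f = Hom.baseChange (AlgebraicClosure K) f := fun _ ↦ rfl
  have hφinj : Function.Injective φ := fun _ _ hfg ↦
    Hom.baseChange_injective (AlgebraicClosure K) hfg
  -- the Frobenius and its central power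
  set π : End P := End.of (frobeniusHom P) with hπ
  set πb : End P' := End.of (Hom.baseChange (AlgebraicClosure K) (frobeniusHom P)) with hπb
  have hφπ : ∀ n : ℕ, φ (π ^ n) = πb ^ n := fun n ↦ by rw [map_pow]; rfl
  obtain ⟨N, hN0, hN⟩ := exists_forall_commute_baseChange_frobeniusHom_pow P
  have hcb : ∀ (f : End P) (n : ℕ), Commute (πb ^ n) (φ f) := fun f n ↦
    ((commute_baseChange_frobeniusHom_baseChange P f).pow_left n)
  -- the symmetrised conjugation `S(r) = ∑_{i<N} πⁱ r π^{N-i}` commutes with `π_K̄`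
  let S : End P' → End P' := fun r ↦ ∑ i ∈ Finset.range N, πb ^ i * r * πb ^ (N - i)
  have hS : ∀ r, S r = ∑ i ∈ Finset.range N, πb ^ i * r * πb ^ (N - i) := fun _ ↦ rfl
  have hSc : ∀ r, Commute πb (S r) := by
    intro r
    let a : ℕ → End P' := fun j ↦ πb ^ j * r * πb ^ (N + 1 - j)
    have e1 : πb * S r = ∑ i ∈ Finset.range N, a (i + 1) := by
      rw [hS, Finset.mul_sum]
      refine Finset.sum_congr rfl fun i hi ↦ ?_
      have hi' : i < N := Finset.mem_range.mp hi
      change πb * (πb ^ i * r * πb ^ (N - i)) = πb ^ (i + 1) * r * πb ^ (N + 1 - (i + 1))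
      rw [Nat.add_sub_add_right, pow_succ', mul_assoc, mul_assoc, mul_assoc]
    have e2 : S r * πb = ∑ i ∈ Finset.range N, a i := by
      rw [hS, Finset.sum_mul]
      refine Finset.sum_congr rfl fun i hi ↦ ?_
      have hi' : i < N := Finset.mem_range.mp hi
      change πb ^ i * r * πb ^ (N - i) * πb = πb ^ i * r * πb ^ (N + 1 - i)
      rw [mul_assoc, ← pow_succ, show N - i + 1 = N + 1 - i by omega]
    have e3 : a 0 = a N := by
      change πb ^ 0 * r * πb ^ (N + 1 - 0) = πb ^ N * r * πb ^ (N + 1 - N)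
      rw [pow_zero, one_mul, Nat.sub_zero, Nat.add_sub_cancel_left, pow_one, pow_succ, ← mul_assoc,
        (hN r).eq]
    have e4 : ∑ i ∈ Finset.range (N + 1), a i = (∑ i ∈ Finset.range N, a (i + 1)) + a 0 :=
      Finset.sum_range_succ' a N
    have e5 : ∑ i ∈ Finset.range (N + 1), a i = (∑ i ∈ Finset.range N, a i) + a N :=
      Finset.sum_range_succ a N
    change πb * S r = S r * πb
    rw [e1, e2]
    have := e4.symm.trans e5
    rw [e3] at this
    exact add_right_cancel this
  -- the trace `τ = φ⁻¹ ∘ S`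
  have hdesc : ∀ r, ∃ s : End P, φ s = S r := fun r ↦ by
    obtain ⟨s, hs⟩ := exists_baseChange_eq_of_commute_frobeniusHom P (S r) (hSc r)
    exact ⟨s, by rw [hφ, hs]⟩
  choose τf hτf using hdesc
  have hSadd : ∀ r r', S (r + r') = S r + S r' := fun r r' ↦ by
    simp only [hS, ← Finset.sum_add_distrib, mul_add, add_mul]
  let τ : End P' →+ End P := AddMonoidHom.mk' τf fun r r' ↦ hφinj (by
    rw [map_add, hτf, hτf, hτf, hSadd])
  have hτ : ∀ r, φ (τ r) = S r := hτf
  have hl : ∀ (a : End P) (r : End P'), τ (φ a * r) = a * τ r := fun a r ↦ hφinj (by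
    rw [hτ, map_mul, hτ, hS, hS, Finset.mul_sum]
    refine Finset.sum_congr rfl fun i _ ↦ ?_
    rw [← mul_assoc, ← mul_assoc, ← mul_assoc, (hcb a i).eq])
  have hr : ∀ (r : End P') (b : End P), τ (r * φ b) = τ r * b := fun r b ↦ hφinj (by
    rw [hτ, map_mul, hτ, hS, hS, Finset.sum_mul]
    refine Finset.sum_congr rfl fun i _ ↦ ?_
    rw [mul_assoc, mul_assoc, mul_assoc, mul_assoc, ← (hcb b (N - i)).eq])
  have h1 : τ 1 = N • π ^ N := hφinj (by
    rw [hτ, hS, map_nsmul, hφπ]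
    simp only [mul_one]
    rw [Finset.sum_congr rfl fun i hi ↦ (pow_add πb i (N - i)).symm.trans
      (by rw [Nat.add_sub_cancel' (Finset.mem_range.mp hi).le]), Finset.sum_const,
      Finset.card_range])
  have hcc : ∀ a : End P, Commute (N • π ^ N) a := fun a ↦
    Commute.smul_left ((commute_frobeniusHom_pow P a N)) N
  -- conclude
  exact @isSemisimpleRing_ratTensor_of_trace_central (End P) (End P') _ _ φ τ (N • π ^ N) hl hr
    h1 (@isUnit_one_tmul_nsmul_of_cancel (End P) _ ‹_› (π ^ N) N hN0.ne'
      (fun g hg ↦ eq_of_frobeniusHom_pow_mul_eq P N (hg.trans (mul_zero _).symm))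
      (fun g hg ↦ eq_of_mul_frobeniusHom_pow_eq P N (hg.trans (zero_mul _).symm))) hcc hss

end Semisimple

end AbelianVariety


/-! ## `End⁰_K(P)` is semisimple over a finite field from the Theorem of the Cube and Poincaré over `K̄` -/

section EndSemisimple

open AbelianVariety

variable {K : Type u} [Field K] [Finite K]

/-- **`End⁰_K(P)` is a semisimple `ℚ`-algebra for every abelian variety `P` over a finite field
`K`, granted the Theorem of the Cube and Poincaré's complete reducibility theorem over `K̄`**
(Mumford §19 Cor. 2 of Thm. 1 over `K̄` — `isSemisimpleRing_endAlgebra_of_mumford19` with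
`hsimple_of_isAlgClosed` — descended to `K` by
`isSemisimpleRing_endAlgebra_of_baseChange_algebraicClosure`; finite generation of `End(P_K̄)` and
`End(P)` is Mumford §19 Thm. 3, `module_finite_hom_of_theoremOfCube_of_poincare(_algebraicClosure)`).
Over a finite field this is Tate 1966, §1 / Milne, *The Work of John Tate*, §4.3 ("`End⁰(A)` is a
semisimple `ℚ`-algebra with centre `ℚ[π]`" — the centre statement is not proved here).
[cite: Tate1966Endomorphisms, §1] -/
theorem AbelianVariety.isSemisimpleRing_endAlgebra_of_theoremOfCube_of_poincare_algebraicClosure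
    (hcube : theoremOfCube_linEquiv.{u})
    (hP1 : ∀ (X Y : AbelianVariety (AlgebraicClosure K)) (i : Y ⟶ X),
      IsClosedImmersion (Hom.toSchemeHom i) → 0 < Y.dim → Y.dim < X.dim →
      ∃ (Z : AbelianVariety (AlgebraicClosure K)) (j : Z ⟶ X),
        IsClosedImmersion (Hom.toSchemeHom j) ∧ IsIsogeny (biprod.desc i j))
    (P : AbelianVariety K) : IsSemisimpleRing (endAlgebra P) := by
  haveI : Module.Finite ℤ (End (P.baseChange (AlgebraicClosure K))) :=
    module_finite_hom_of_theoremOfCube_of_poincare hcube hP1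
      (hsimple_of_isAlgClosed (AlgebraicClosure K)) _ _
  haveI : Module.Finite ℤ (End P) :=
    module_finite_hom_of_theoremOfCube_of_poincare_algebraicClosure hcube hP1 P P
  exact isSemisimpleRing_endAlgebra_of_baseChange_algebraicClosure P
    (isSemisimpleRing_endAlgebra_of_mumford19 hP1 (hsimple_of_isAlgClosed (AlgebraicClosure K)) _)

end EndSemisimple

end Literature.AlgebraicGeometry.Motives
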